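import Mathlib.Data.ZMod.Basic
import Mathlib.Data.Fintype.Pigeonhole
import Mathlib.Tactic

/-!
# ω-census, family (b3): conjecture C9 on the Frobenius family — Thue's lemma: a short vector `(x, y)` with `y ≡ u x (mod p)`

HONEST FRAMING (pub-omega census; verbatim): lottery ticket; floor = certified bounds/negative ranges.
Census BOOKKEEPING (conjecture C9 of the cell; pub-omega stpp-1 gen 20).  Layer 4 of the seat's uniform construction for
`ℤ/p ⋊_u ℤ/3` (design note HOME/pub-omega-stpp-1-g20/UNIFORM-FROBENIUS-DESIGN.md): the lattice `{(x, y) : y ≡ u x (mod p)}` has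
a short primitive vector.  `PhaseArcs.thue`: for `p ≥ 2` and any `u : ZMod p` there are integers `0 < x`, `y` with `x·x ≤ p`,
`y·y ≤ p` (i.e. `x, |y| ≤ √p`) and `(y : ZMod p) = u * x` (pigeonhole on `(i, j) ↦ i + u j` over `[0, ⌊√p⌋]²`, which has more
than `p` points); `PhaseArcs.thue_primitive`: for odd `p` one may moreover
take `x, y` not both even (halve otherwise).  These `x = e₀`, `y = e₁` are the ERRORS of the phase construction: with
`α := e₀ · 8⁻¹` one has `8α ≡ e₀`, `8uα ≡ e₁ (mod p)`.  Nothing here is progress on `ω`.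
-/

namespace Summit.MatrixMultiplication.OmegaCensus

namespace PhaseArcs

/-- **Thue's lemma (lattice form).** For `p ≥ 2` and `u : ZMod p` there are integers `0 < x`, `y` with `x·x ≤ p`, `y·y ≤ p` and
`y ≡ u x (mod p)`. [folklore] -/
theorem thue (p : ℕ) [NeZero p] (hp : 2 ≤ p) (u : ZMod p) :
    ∃ x y : ℤ, 0 < x ∧ x * x ≤ p ∧ y * y ≤ p ∧ (y : ZMod p) = u * x := by
  set n := Nat.sqrt p with hn
  -- pigeonhole: (n+1)² > p points (i, j) ↦ i + u j
  have hcard : Fintype.card (ZMod p) < Fintype.card (Fin (n + 1) × Fin (n + 1)) := by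
    rw [ZMod.card, Fintype.card_prod, Fintype.card_fin]
    have := Nat.lt_succ_sqrt' p
    rw [pow_two] at this
    exact this
  obtain ⟨a, b, hab, heq⟩ := Fintype.exists_ne_map_eq_of_card_lt
    (fun ij : Fin (n + 1) × Fin (n + 1) => ((ij.1 : ℕ) : ZMod p) + u * ((ij.2 : ℕ) : ZMod p)) hcard
  -- x := b.2 - a.2, y := a.1 - b.1 :  y ≡ u x
  have hn2 : (n : ℤ) * n ≤ p := by exact_mod_cast Nat.sqrt_le p
  have ha1 := a.1.isLt; have ha2 := a.2.isLt; have hb1 := b.1.isLt; have hb2 := b.2.isLt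
  set x : ℤ := (b.2 : ℕ) - (a.2 : ℕ) with hx
  set y : ℤ := (a.1 : ℕ) - (b.1 : ℕ) with hy
  have hxy : (y : ZMod p) = u * x := by
    simp only [hx, hy]; push_cast; linear_combination heq
  have hxb : x * x ≤ p := by
    have : |x| ≤ n := by rw [abs_le]; constructor <;> omega
    calc x * x = |x| * |x| := (abs_mul_abs_self x).symm
      _ ≤ n * n := by apply mul_le_mul this this (abs_nonneg x) (by positivity)
      _ ≤ p := hn2
  have hyb : y * y ≤ p := by
    have : |y| ≤ n := by rw [abs_le]; constructor <;> omega
    calc y * y = |y| * |y| := (abs_mul_abs_self y).symm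
      _ ≤ n * n := by apply mul_le_mul this this (abs_nonneg y) (by positivity)
      _ ≤ p := hn2
  -- x ≠ 0: otherwise y ≡ 0 with |y| ≤ n < p forces y = 0 and (a = b)
  rcases lt_trichotomy x 0 with hneg | hzero | hpos
  · refine ⟨-x, -y, by omega, by nlinarith, by nlinarith, ?_⟩
    push_cast; rw [hxy]; ring
  · exfalso
    have hy0 : (y : ZMod p) = 0 := by rw [hxy, hzero]; push_cast; ring
    rw [ZMod.intCast_zmod_eq_zero_iff_dvd] at hy0
    have hyabs : |y| < p := by
      have h1 : |y| ≤ n := by rw [abs_le]; constructor <;> omega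
      have h2 : (n : ℤ) < p := by
        have := Nat.sqrt_lt_self (by omega : 1 < p)
        exact_mod_cast this
      omega
    have hy00 : y = 0 := by
      rcases hy0 with ⟨k, hk⟩
      rcases lt_trichotomy k 0 with hk0 | hk0 | hk0
      · have : y ≤ -p := by nlinarith
        rw [abs_lt] at hyabs; omega
      · rw [hk, hk0, mul_zero]
      · have : (p : ℤ) ≤ y := by nlinarith
        rw [abs_lt] at hyabs; omega
    apply hab
    have e1 : a.1 = b.1 := by ext; omega
    have e2 : a.2 = b.2 := by ext; omega
    exact Prod.ext e1 e2
  · exact ⟨x, y, hpos, hxb, hyb, hxy⟩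

/-- **Primitive short vector.** For odd `p ≥ 3` one may take the short vector of `thue` with `x, y` not both even. [folklore] -/
theorem thue_primitive (p : ℕ) [NeZero p] (hp : 3 ≤ p) (hodd : Odd p) (u : ZMod p) :
    ∃ x y : ℤ, 0 < x ∧ x * x ≤ p ∧ y * y ≤ p ∧ (y : ZMod p) = u * x ∧ ¬ (2 ∣ x ∧ 2 ∣ y) := by
  -- strong induction on x: halve while both are even
  suffices H : ∀ m : ℕ, ∀ x y : ℤ, x.toNat = m → 0 < x → x * x ≤ p → y * y ≤ p → (y : ZMod p) = u * x →
      ∃ x y : ℤ, 0 < x ∧ x * x ≤ p ∧ y * y ≤ p ∧ (y : ZMod p) = u * x ∧ ¬ (2 ∣ x ∧ 2 ∣ y) by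
    obtain ⟨x, y, h0, h1, h2, h3⟩ := thue p (by omega) u
    exact H x.toNat x y rfl h0 h1 h2 h3
  intro m
  induction m using Nat.strong_induction_on with
  | _ m ih =>
    intro x y hm h0 h1 h2 h3
    by_cases hev : 2 ∣ x ∧ 2 ∣ y
    · obtain ⟨⟨x', hx'⟩, ⟨y', hy'⟩⟩ := hev
      have h2inv : (2 : ZMod p) * (((p + 1) / 2 : ℕ) : ZMod p) = 1 := by
        obtain ⟨k, hk⟩ := hodd
        have hk1 : (p + 1) / 2 = k + 1 := by omega
        rw [hk1]
        have h : ((2 * (k + 1) : ℕ) : ZMod p) = ((p + 1 : ℕ) : ZMod p) := by congr 1; omega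
        push_cast at h ⊢
        rw [ZMod.natCast_self] at h
        linear_combination h
      have h1' : x' * x' ≤ p := by rw [hx'] at h1; nlinarith [mul_self_nonneg x']
      have h2' : y' * y' ≤ p := by rw [hy'] at h2; nlinarith [mul_self_nonneg y']
      refine ih x'.toNat (by omega) x' y' rfl (by omega) h1' h2' ?_
      -- y' ≡ u x' : multiply y ≡ u x by the inverse of 2
      have e : (2 : ZMod p) * ((y' : ZMod p) - u * x') = 0 := by
        have := h3; rw [hx', hy'] at this; push_cast at this; linear_combination this
      have := congrArg (fun z => (((p + 1) / 2 : ℕ) : ZMod p) * z) e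
      simp only [mul_zero] at this
      rw [← mul_assoc, mul_comm _ (2 : ZMod p), h2inv, one_mul, sub_eq_zero] at this
      exact this
    · exact ⟨x, y, h0, h1, h2, h3, hev⟩

end PhaseArcs

end Summit.MatrixMultiplication.OmegaCensus
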